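/-
Copyright (c) 2026 the pub-hodgecm-mathlib formalisation cell (harness21).  R90-TF SLAB, section S10 (Rogawski 1990, §13.8 p. 219 L3 «π_w = ξ_H(ρ_w)» at a SPLIT
place `w ≠ v` ∕ §4.13 Lemma 4.13.1 (a) ∕ §4.9 Prop. 4.9.1 (a)), prover K2Liu-p13 (g5); RE-DEAL #52+#56 «hbc-split» (S10 dealer R90-C138-plan (g3), R90 bus 02:43:24Z (2));
census `R90/R90-C138-p13/CENSUS-DEAL56-hbcSplit.p13-g5.md` (baa763f3d1a0d5cd); h413 = `stmt-HodgeConjecture-24833`, route `HCCMUnconditional`.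
-/
import Summits.HodgeConjecture.HodgeConjecture.Theorems.R90S3BCSphericalRigidity            -- ★ p864659 (R-a)(R-b)(R-c): rigidity of the `LiesOver` fibre modulo `hFL`
import Summits.HodgeConjecture.HodgeConjecture.Theorems.R90S10SplitMaxCompactEqIntegralLevel   -- ★ (M-d) `cmSplitMaxCompact_qsForm_eq_cmLocalIntegralLevel`
import Literature.NumberTheory.Rogawski1990.SmoothTransferSplitPlaceNamed                     -- ★ `isLocalDeltaTransfer_cmSplitTransfer`, `cmSplitTransfer`, `cmConstantTermSplit`
import Literature.NumberTheory.Rogawski1990.UnitFundamentalLemmaSplitPlaceLeviSides            -- ★ `reindexGL_finSumFinEquiv_blockDiagGL_mem_glInt_iff`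
import Literature.NumberTheory.Automorphic.GLnTwoBlockUnipotentHaarTransport                   -- ★ `integral_prod_unipotent_mul_parabolic_eq_smul`
import Literature.NumberTheory.Automorphic.GLnParabolicRootDeltaBoxAd                          -- ★ `rootDeltaChar_standardParabolicGL_eq_sqrt_normAbs_det_boxAd`
import Literature.NumberTheory.Automorphic.ParabolicIndGLSphericalUnramified                   -- ★ `rootDeltaChar_eq_one_of_mem_glInt`
import Literature.NumberTheory.Automorphic.HeckeCharacterLocalComponentSmooth                  -- ★ `IsUnramifiedAt.localComponent_eq_one_of_valuation_eq_one`
import Literature.NumberTheory.Automorphic.HeckeTransversalGL                                  -- ★ `valuation_det_eq_one_of_mem_glInt`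
import HarnessLib

/-!
# R90-TF ∕ S10 — THE BC-SPHERICAL INPUT `hbc` AT A SPLIT PLACE: the `LiesOver` fibre over `ρ_w` is rigid at `w` split, unramified
# (`Theorems/R90S10BCSphericalRigiditySplit.lean`; ns `Summit.HodgeConjecture.HodgeConjecture.R90.S10`; THEOREMS ONLY, ★-only imports, 0 `sorry`)

THE PRINT.  [Rogawski1990, §13.8 p. 219 L3]: «`π_w = ξ_H(ρ_w)` for all `w ≠ v` and all `π` occurring in the sum».  At a place `w` of `L⁺` SPLIT in `L` the transfer
`φ → φ^H` is parabolic descent [§4.13 Lemma 4.13.1 (a) pp. 64–66; §4.9 Prop. 4.9.1 (a) pp. 54–55]: `φ^H = τ_w · φ̄^P` (★ `UnitaryGroup.cmSplitTransfer`, the normalised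
constant term `φ̄^P(m) = δ_P(m)^{1∕2} ∫_K ∫_U φ(k m u k⁻¹) du dk` times `τ_w(h) = μ_w(det h₂)`), and `φ ↦ φ̄^P` maps `C_c^∞(G_w ∕∕ K_w)` to `C_c^∞(M_w ∕∕ K_w ∩ M_w)`
[CartierCorvallis1979, §IV.1–IV.2; BernsteinZelevinsky1977, §2.3] — so the FL-existence hypothesis `hFL` of ★ p864659 (R-c)
`R90.S3.unopClassSphericalCharacter_eq_of_liesOver_of_sphTransfer` («every `K_w`-bi-invariant `φ` has a `K_{H,w}`-bi-invariant `Δ_w`-transfer») is DISCHARGED at split `w`.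

WHAT THIS FILE PROVES (all over ★ statements; the one new piece of mathematics is §1 (s1), the LEVEL of `τ_w · φ̄^P`):
* §1 (generic hermitian `H′`, any place `v` of `L⁺`, `W ∣ v` with `c • W ≠ W`):
  `cmSplitLeviCompact_eq_prod_cmLocalIntegralLevel` — `K_H = U(Φ₂)(𝒪_v) × U(Φ₁)(𝒪_v)` (★ `mem_localIntegralLevel_iff_of_ne`, ★ `reindexGL_finSumFinEquiv_blockDiagGL_mem_glInt_iff`);
  `cmConstantTermSplit_apply_mul_eq_of_mem` — `φ̄^P(x h) = φ̄^P(h) = φ̄^P(h x)` for `x ∈ K_H` and `φ` bi-`K′`-invariant: left by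
  `k (m_x m_h u) k⁻¹ = (k m_x k⁻¹)(k (m_h u) k⁻¹)` and `δ^{1∕2} = 1` on `GL₃(𝒪)` (★ `rootDeltaChar_eq_one_of_mem_glInt`); right by ★ `integral_prod_unipotent_mul_parabolic_eq_smul`
  (`∫ ψ(k (u p) k⁻¹) = ‖det K_p‖ ∫ ψ(k (p u) k⁻¹)` for EVERY `ψ`, Rogawski p. 70) at `p = m_h m_x` and `p = m_h`, `‖det K_p‖ = δ_P(p)` (★
  `rootDeltaChar_standardParabolicGL_eq_sqrt_normAbs_det_boxAd`) multiplicative and `= 1` at `m_x` — no new Haar-uniqueness argument;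
  `isLevel_cmSplitTransfer` — (s1) for `μ` UNRAMIFIED at `W` and `φ ∈ C(G′_v ∕∕ K′)`, `τ_w · φ̄^P ∈ C(H_v ∕∕ K_H)` (`τ_w = μ_W ∘ det ∘ e₂ = 1` on `K_H`: ★
  `valuation_det_eq_one_of_mem_glInt`, ★ `IsUnramifiedAt.localComponent_eq_one_of_valuation_eq_one`).
* §2 `sphTransfer_exists_of_split` — (R-c)'s `hFL` AT A SPLIT PLACE in the frozen currency (`Gqs`, `HLoc`, ★ `MatchE1`): witness `fH := cmSplitTransfer … φ` (p06 (g0)'s letter bytes),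
  `MatchE1` by ★ `isLocalDeltaTransfer_cmSplitTransfer` ON THE NOSE (s2), levels of record by ★ (M-d) `cmSplitMaxCompact_qsForm_eq_cmLocalIntegralLevel` (`K′ = U(Φ₃)(𝒪_w)`) and §1.
* §3 HEAD `unopClassSphericalCharacter_eq_of_liesOver_of_split` (two-`LiesOver` form, as #53's inert twin) and the class form `eq_of_liesOver_of_split` := ★ (R-c) ∕ (R-b) ∘ §2.
* §4 `eq_and_unopClassSphericalCharacter_eq_of_liesOver_frozen_of_split` — the same for the frozen datum `𝔣` at `w ≠ v` (levels ∕ measures ∕ families of record, instances from `𝔣`'s fields),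
  in the shape of the `hbc` binder of ★ `germOfMembersLetter_of_bcSpherical` ∕ ★ `rigidityAtGermLetter_of_liesOver` (spherical characters at `U(Φ₃)(𝒪_w)`, any witnesses).
BY-VALUE INPUTS OF THE HEAD, each named: `hunr : μ.IsUnramifiedAt W.1` (⟪U⟫ `(hunr w hw W).2` of ★ `R90S10GermPinsOfRecordDefs`; NECESSARY — else `τ_w` is not `K_{2,w}`-invariant),
`hdual : galConj c μ = μ⁻¹` (⇐ the slab's `hμω`, ★ `galConj_eq_inv_of_restrict_eq_quadraticHeckeCharCM`), canonicity `hcanH hcanQ` (= `𝔳.hmH ∕ 𝔳.hmQ ⟨w, hw⟩`), admissibility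
`hadm hadm₀` (as (R-c)).  HONEST LABEL: discharges (R-c)'s `hFL` at split unramified `w` only (inert `w`: #53, K2E3-p21 (g9), S6 floor (E1-c)); pays no socket by itself;
HC_CM is proved only modulo the 7 printed citations (2 remaining named inputs: hLiu418 = `stmt-HodgeConjecture-24832`, h413 = `stmt-HodgeConjecture-24833`) until rung 0
closes; REL ≠ ★ ≠ BUILT; supports-only lane.

## References
* [Rogawski1990] J. D. Rogawski, *Automorphic Representations of Unitary Groups in Three Variables*, Ann. of Math. Stud. 123 (1990): §4.4 p. 44; §4.9 Prop. 4.9.1 (a)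
  pp. 54–55; §4.13 Lemma 4.13.1 (a) pp. 64–66 and proof p. 70; §13.8 p. 219 L3.
* [CartierCorvallis1979] P. Cartier, *Representations of p-adic groups: a survey*, Proc. Sympos. Pure Math. 33 (1979), Part 1, §IV.1–IV.2 (constant term on `ℋ(G, K)`).
* [BernsteinZelevinsky1977] I. N. Bernstein, A. V. Zelevinsky, *Induced representations of reductive p-adic groups. I*, Ann. Sci. ÉNS 10 (1977), 1.7, §2.3.
-/

set_option autoImplicit false
-- the mandated namespace has the single-problem summit's repeated segment (`HodgeConjecture.HodgeConjecture`)
set_option linter.dupNamespace false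

noncomputable section

open scoped Matrix MatrixGroups NNReal
open MeasureTheory Measure NumberField IsDedekindDomain
open Literature.NumberTheory.Rogawski1990 Literature.NumberTheory.Automorphic Literature.NumberTheory.Automorphic.UnitaryGroup
open Literature.NumberTheory.GaloisRepresentations Literature.NumberTheory.GaloisRepresentations.IsNonarchimedeanLocalField
open Summit.HodgeConjecture.HodgeConjecture.Cruxes.H413.K2E1TraceFormulaBeta
open Summit.HodgeConjecture.HodgeConjecture.Cruxes.H413.K2E1EvpOfAutomorphicClass (unopClassSphericalCharacter)

namespace Summit.HodgeConjecture.HodgeConjecture.R90.S10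

/-! ## §1 The level of the parabolic-descent transfer `τ_w · φ̄^P` (generic hermitian `H′`) -/

section SplitLevel

variable (L : Type) [Field L] [NumberField L] [IsCMField L]
  (v : Pl L) (W : PlacesOver L v) (hW : IsCMField.complexConj L • W.1 ≠ W.1)

/-- **(L-H) `K_H = U(Φ₂)(𝒪_v) × U(Φ₁)(𝒪_v)` at a split place**: the compact open subgroup ★ `cmSplitLeviCompact L v W hW = {h | diag(e₂ h.1, e₁ h.2) ∈ GL₃(𝒪_W)}` of
`H_v` IS the product of the standard integral levels (★ `reindexGL_finSumFinEquiv_blockDiagGL_mem_glInt_iff`: a block-diagonal matrix is integral iff its blocks are; ★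
`mem_localIntegralLevel_iff_of_ne`: `U(Φ_N)(𝒪_v) = e_N⁻¹ GL_N(𝒪_W)`, `Φ_N` hyperspecial ★ `unit_placeForm_antidiagOne_mem_glInt`). [cite: Rogawski1990, §4.4 p. 44]
[cite: PlatonovRapinchuk1994, §5.1] -/
theorem cmSplitLeviCompact_eq_prod_cmLocalIntegralLevel :
    cmSplitLeviCompact L v W hW =
      (cmLocalIntegralLevel L 2 (Matrix.of fun i j : Fin 2 => if i.val + j.val + 1 = 2 then (1 : L) else 0) v).prod
        (cmLocalIntegralLevel L 1 (Matrix.of fun i j : Fin 1 => if i.val + j.val + 1 = 1 then (1 : L) else 0) v) := by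
  ext x
  rw [mem_cmSplitLeviCompact_iff, cmSplitLeviGL_apply, Subgroup.mem_prod]
  refine (reindexGL_finSumFinEquiv_blockDiagGL_mem_glInt_iff (k := 2) (l := 1) _).trans (and_congr ?_ ?_)
  · rw [cmSplitEquivTwo_eq L v W hW (antidiagOne_map_transpose (IsCMField.complexConj L) 2) (isUnit_placeForm_antidiagOne (E := L) 2 W.1)]
    exact (mem_localIntegralLevel_iff_of_ne (IsCMField.complexConj L) 2 _ (IsCMField.complexConj_ne_one L) _ W hW _
      (unit_placeForm_antidiagOne_mem_glInt (E := L) 2 W.1) x.1).symm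
  · rw [cmSplitEquivOne_eq L v W hW (antidiagOne_map_transpose (IsCMField.complexConj L) 1) (isUnit_placeForm_antidiagOne (E := L) 1 W.1)]
    exact (mem_localIntegralLevel_iff_of_ne (IsCMField.complexConj L) 1 _ (IsCMField.complexConj_ne_one L) _ W hW _
      (unit_placeForm_antidiagOne_mem_glInt (E := L) 1 W.1) x.2).symm

/-- `K_H` is compact and open (a product of two compact open integral levels, ★ `isCompact_isOpen_cmLocalIntegralLevel`). [cite: Rogawski1990, §4.4 p. 44]
[cite: PlatonovRapinchuk1994, §5.1] -/
theorem isCompact_isOpen_cmSplitLeviCompact :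
    IsCompact (cmSplitLeviCompact L v W hW : Set (HLoc L v)) ∧ IsOpen (cmSplitLeviCompact L v W hW : Set (HLoc L v)) := by
  rw [cmSplitLeviCompact_eq_prod_cmLocalIntegralLevel, Subgroup.coe_prod]
  exact ⟨(isCompact_isOpen_cmLocalIntegralLevel L 2 _ v).1.prod (isCompact_isOpen_cmLocalIntegralLevel L 1 _ v).1,
    (isCompact_isOpen_cmLocalIntegralLevel L 2 _ v).2.prod (isCompact_isOpen_cmLocalIntegralLevel L 1 _ v).2⟩

variable (H' : Matrix (Fin 3) (Fin 3) L) (hH' : (H'.map (cmConjRingHom L))ᵀ = H') (hH'd : IsUnit H'.det)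

/-- **`φ̄^P(x h) = φ̄^P(h) = φ̄^P(h x)` for `x ∈ K_H` and `φ` BI-`K′`-invariant.**  Write `φ̄^P(g) = δ_P^{1∕2}(m_g) · I(m_g)`, `I(p) := ∫_{K×U} ψ(k (p u) k⁻¹)`,
`ψ = φ ∘ e′⁻¹` (bi-`GL₃(𝒪_W)`-invariant), `m_g = diag(e₂ g.1, e₁ g.2)` (★ `cmSplitLeviGL`, a homomorphism), and let `x ∈ K_H`, i.e. `m_x ∈ GL₃(𝒪_W)`, so `δ_P^{1∕2}(m_x) = 1` (★
`rootDeltaChar_eq_one_of_mem_glInt`).  LEFT: `k (m_x m_h u) k⁻¹ = (k m_x k⁻¹) · (k (m_h u) k⁻¹)` and `e′⁻¹(k m_x k⁻¹) ∈ K′`, so `I(m_x m_h) = I(m_h)` pointwise.  RIGHT: the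
conjugation `u ↦ m_x u m_x⁻¹` preserves the normalised Haar measure of `U`, packaged by ★ `integral_prod_unipotent_mul_parabolic_eq_smul` — `J(p) := ∫ ψ(k (u p) k⁻¹) = ‖det K_p‖ · I(p)`
for EVERY `ψ` [Rogawski p. 70 «by a change of variables»]: `J(m_h m_x) = J(m_h)` pointwise by right invariance (`k (u m_h m_x) k⁻¹ = (k (u m_h) k⁻¹)(k m_x k⁻¹)`), and `‖det K_p‖ =
δ_P(p)` (★ `rootDeltaChar_standardParabolicGL_eq_sqrt_normAbs_det_boxAd`, squared) is multiplicative, `= 1` at `m_x` and non-zero, so `I(m_h m_x) = I(m_h)`.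
[cite: Rogawski1990, §4.13 Lemma 4.13.1 (a) p. 64 and proof p. 70] [cite: BernsteinZelevinsky1977, 1.7 and §2.3] [cite: CartierCorvallis1979, §IV.1] -/
theorem cmConstantTermSplit_apply_mul_eq_of_mem {f : (cmDatum L 3 H').Local v → ℂ} (hf : IsLevel (cmSplitMaxCompact L v W hW H' hH' hH'd) f)
    {x : HLoc L v} (hx : x ∈ cmSplitLeviCompact L v W hW) (h : HLoc L v) :
    cmConstantTermSplit L H' hH' hH'd v W hW f (x * h) = cmConstantTermSplit L H' hH' hH'd v W hW f h ∧
      cmConstantTermSplit L H' hH' hH'd v W hW f (h * x) = cmConstantTermSplit L H' hH' hH'd v W hW f h := by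
  -- (0) instances on `F = L_W`, `GL₃(F)`, `K = GL₃(𝒪)`, `U`
  letI : MeasurableSpace (W.1.adicCompletion L) := borel _
  haveI : BorelSpace (W.1.adicCompletion L) := ⟨rfl⟩
  letI : MeasurableSpace (GL (Fin 3) (W.1.adicCompletion L)) := borel _
  haveI : BorelSpace (GL (Fin 3) (W.1.adicCompletion L)) := ⟨rfl⟩
  haveI : LocallyCompactSpace (GL (Fin 3) (W.1.adicCompletion L)) := locallyCompactSpace_gl_adicCompletion L 3 W.1
  haveI : BorelSpace ↥(glInt 3 (W.1.adicCompletion L)) := Subtype.borelSpace _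
  haveI : CompactSpace ↥(glInt 3 (W.1.adicCompletion L)) := isCompact_iff_compactSpace.1 (isCompact_glInt 3 (W.1.adicCompletion L))
  haveI : BorelSpace ↥(unipotentRadicalGL (W.1.adicCompletion L) (Zelevinsky1980.lastBlockLabel 3)) := Subtype.borelSpace _
  haveI : LocallyCompactSpace ↥(unipotentRadicalGL (W.1.adicCompletion L) (Zelevinsky1980.lastBlockLabel 3)) :=
    (isClosed_unipotentRadicalGL (R := W.1.adicCompletion L) (Zelevinsky1980.lastBlockLabel 3)).isClosedEmbedding_subtypeVal.locallyCompactSpace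
  haveI : IsHaarMeasure (haarMeasure (unipotentIntPositiveCompacts (W.1.adicCompletion L))) := isHaarMeasure_haarMeasure _
  haveI : IsFiniteMeasure (haarMeasure (glIntPositiveCompacts (W.1.adicCompletion L))) := CompactSpace.isFiniteMeasure
  -- (1) notation: the parabolic `P`, the frame `e′`, the Levi points `p_g = m_g ∈ P`, the `K × U`-integral `I(p)`; `φ̄^P(g) = δ^{1∕2}(p_g) · I(p_g)` definitionally
  set P : Subgroup (GL (Fin 3) (W.1.adicCompletion L)) := standardParabolicGL (W.1.adicCompletion L) (Zelevinsky1980.lastBlockLabel 3) with hPdef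
  let e' : (cmDatum L 3 H').Local v ≃ₜ* GL (Fin 3) (W.1.adicCompletion L) := localSplitEquiv (IsCMField.complexConj L) H' (IsCMField.complexConj_ne_one L)
    ((map_cmConjRingHom_eq_map_complexConj L H') ▸ hH') W hW (isUnit_placeForm_of_isUnit_det hH'd W.1)
  let I : ↥P → ℂ := fun p => ∫ q : ↥(glInt 3 (W.1.adicCompletion L)) × ↥(unipotentRadicalGL (W.1.adicCompletion L) (Zelevinsky1980.lastBlockLabel 3)),
      f (e'.symm ((q.1 : GL (Fin 3) (W.1.adicCompletion L)) * ((p : GL (Fin 3) (W.1.adicCompletion L)) * (q.2 : GL (Fin 3) (W.1.adicCompletion L))) *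
        (q.1 : GL (Fin 3) (W.1.adicCompletion L))⁻¹))
      ∂((haarMeasure (glIntPositiveCompacts (W.1.adicCompletion L))).prod (haarMeasure (unipotentIntPositiveCompacts (W.1.adicCompletion L))))
  have hCT : ∀ g : HLoc L v, cmConstantTermSplit L H' hH' hH'd v W hW f g =
      ((rootDeltaChar P ⟨cmSplitLeviGL L v W hW g, cmSplitLeviGL_mem_standardParabolicGL L v W hW g⟩ : ℂˣ) : ℂ) *
        I ⟨cmSplitLeviGL L v W hW g, cmSplitLeviGL_mem_standardParabolicGL L v W hW g⟩ := fun g => rfl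
  set ph : ↥P := ⟨cmSplitLeviGL L v W hW h, cmSplitLeviGL_mem_standardParabolicGL L v W hW h⟩ with hph
  set px : ↥P := ⟨cmSplitLeviGL L v W hW x, cmSplitLeviGL_mem_standardParabolicGL L v W hW x⟩ with hpx
  have hxK : (px : GL (Fin 3) (W.1.adicCompletion L)) ∈ glInt 3 (W.1.adicCompletion L) := (mem_cmSplitLeviCompact_iff L v W hW x).1 hx
  have hPl : (⟨cmSplitLeviGL L v W hW (x * h), cmSplitLeviGL_mem_standardParabolicGL L v W hW (x * h)⟩ : ↥P) = px * ph := Subtype.ext (map_mul _ _ _)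
  have hPr : (⟨cmSplitLeviGL L v W hW (h * x), cmSplitLeviGL_mem_standardParabolicGL L v W hW (h * x)⟩ : ↥P) = ph * px := Subtype.ext (map_mul _ _ _)
  have hδx : rootDeltaChar P px = 1 := rootDeltaChar_eq_one_of_mem_glInt px hxK
  have hδl : rootDeltaChar P (px * ph) = rootDeltaChar P ph := by rw [map_mul, hδx, one_mul]
  have hδr : rootDeltaChar P (ph * px) = rootDeltaChar P ph := by rw [map_mul, hδx, mul_one]
  -- (2) bi-`GL₃(𝒪)`-invariance of `ψ = f ∘ e′⁻¹`
  have hψl : ∀ (z y : GL (Fin 3) (W.1.adicCompletion L)), z ∈ glInt 3 (W.1.adicCompletion L) → f (e'.symm (z * y)) = f (e'.symm y) := fun z y hz => by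
    rw [map_mul]
    refine hf.mul_left _ ?_ _
    rw [mem_cmSplitMaxCompact_iff]
    show e' (e'.symm z) ∈ glInt 3 (W.1.adicCompletion L)
    rw [ContinuousMulEquiv.apply_symm_apply]
    exact hz
  have hψr : ∀ (y z : GL (Fin 3) (W.1.adicCompletion L)), z ∈ glInt 3 (W.1.adicCompletion L) → f (e'.symm (y * z)) = f (e'.symm y) := fun y z hz => by
    rw [map_mul]
    refine hf.mul_right _ ?_ _
    rw [mem_cmSplitMaxCompact_iff]
    show e' (e'.symm z) ∈ glInt 3 (W.1.adicCompletion L)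
    rw [ContinuousMulEquiv.apply_symm_apply]
    exact hz
  have hkxk : ∀ k : ↥(glInt 3 (W.1.adicCompletion L)),
      (k : GL (Fin 3) (W.1.adicCompletion L)) * (px : GL (Fin 3) (W.1.adicCompletion L)) * (k : GL (Fin 3) (W.1.adicCompletion L))⁻¹ ∈ glInt 3 (W.1.adicCompletion L) :=
    fun k => Subgroup.mul_mem _ (Subgroup.mul_mem _ k.2 hxK) (Subgroup.inv_mem _ k.2)
  -- (3) LEFT: `I(p_x p_h) = I(p_h)` pointwise
  have hIl : I (px * ph) = I ph := by
    refine integral_congr_ae (Filter.Eventually.of_forall fun q => ?_)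
    show f (e'.symm ((q.1 : GL (Fin 3) (W.1.adicCompletion L)) * ((px : GL (Fin 3) (W.1.adicCompletion L)) * (ph : GL (Fin 3) (W.1.adicCompletion L)) *
        (q.2 : GL (Fin 3) (W.1.adicCompletion L))) * (q.1 : GL (Fin 3) (W.1.adicCompletion L))⁻¹)) =
      f (e'.symm ((q.1 : GL (Fin 3) (W.1.adicCompletion L)) * ((ph : GL (Fin 3) (W.1.adicCompletion L)) * (q.2 : GL (Fin 3) (W.1.adicCompletion L))) *
        (q.1 : GL (Fin 3) (W.1.adicCompletion L))⁻¹))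
    rw [show (q.1 : GL (Fin 3) (W.1.adicCompletion L)) * ((px : GL (Fin 3) (W.1.adicCompletion L)) * (ph : GL (Fin 3) (W.1.adicCompletion L)) *
          (q.2 : GL (Fin 3) (W.1.adicCompletion L))) * (q.1 : GL (Fin 3) (W.1.adicCompletion L))⁻¹ =
        ((q.1 : GL (Fin 3) (W.1.adicCompletion L)) * (px : GL (Fin 3) (W.1.adicCompletion L)) * (q.1 : GL (Fin 3) (W.1.adicCompletion L))⁻¹) *
          ((q.1 : GL (Fin 3) (W.1.adicCompletion L)) * ((ph : GL (Fin 3) (W.1.adicCompletion L)) * (q.2 : GL (Fin 3) (W.1.adicCompletion L))) *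
            (q.1 : GL (Fin 3) (W.1.adicCompletion L))⁻¹) by group]
    exact hψl _ _ (hkxk q.1)
  -- (4) RIGHT: ★ `J(p) = ‖det K_p‖ • I(p)` at `p = p_h p_x` and `p = p_h`, `J(p_h p_x) = J(p_h)` pointwise, `‖det K_{p_h p_x}‖ = ‖det K_{p_h}‖ ≠ 0`
  have key := fun p : ↥P => integral_prod_unipotent_mul_parabolic_eq_smul (haarMeasure (glIntPositiveCompacts (W.1.adicCompletion L)))
    (fun k : ↥(glInt 3 (W.1.adicCompletion L)) => (k : GL (Fin 3) (W.1.adicCompletion L)))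
    (haarMeasure (unipotentIntPositiveCompacts (W.1.adicCompletion L))) p (fun y => f (e'.symm y))
  have hJ : ∫ q : ↥(glInt 3 (W.1.adicCompletion L)) × ↥(unipotentRadicalGL (W.1.adicCompletion L) (Zelevinsky1980.lastBlockLabel 3)),
        f (e'.symm ((q.1 : GL (Fin 3) (W.1.adicCompletion L)) * ((q.2 : GL (Fin 3) (W.1.adicCompletion L)) * ((ph * px : ↥P) : GL (Fin 3) (W.1.adicCompletion L))) *
          (q.1 : GL (Fin 3) (W.1.adicCompletion L))⁻¹)) ∂((haarMeasure (glIntPositiveCompacts (W.1.adicCompletion L))).prod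
            (haarMeasure (unipotentIntPositiveCompacts (W.1.adicCompletion L)))) =
      ∫ q : ↥(glInt 3 (W.1.adicCompletion L)) × ↥(unipotentRadicalGL (W.1.adicCompletion L) (Zelevinsky1980.lastBlockLabel 3)),
        f (e'.symm ((q.1 : GL (Fin 3) (W.1.adicCompletion L)) * ((q.2 : GL (Fin 3) (W.1.adicCompletion L)) * (ph : GL (Fin 3) (W.1.adicCompletion L))) *
          (q.1 : GL (Fin 3) (W.1.adicCompletion L))⁻¹)) ∂((haarMeasure (glIntPositiveCompacts (W.1.adicCompletion L))).prod
            (haarMeasure (unipotentIntPositiveCompacts (W.1.adicCompletion L)))) := by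
    refine integral_congr_ae (Filter.Eventually.of_forall fun q => ?_)
    show f (e'.symm ((q.1 : GL (Fin 3) (W.1.adicCompletion L)) * ((q.2 : GL (Fin 3) (W.1.adicCompletion L)) * ((ph : GL (Fin 3) (W.1.adicCompletion L)) *
        (px : GL (Fin 3) (W.1.adicCompletion L)))) * (q.1 : GL (Fin 3) (W.1.adicCompletion L))⁻¹)) =
      f (e'.symm ((q.1 : GL (Fin 3) (W.1.adicCompletion L)) * ((q.2 : GL (Fin 3) (W.1.adicCompletion L)) * (ph : GL (Fin 3) (W.1.adicCompletion L))) *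
        (q.1 : GL (Fin 3) (W.1.adicCompletion L))⁻¹))
    rw [show (q.1 : GL (Fin 3) (W.1.adicCompletion L)) * ((q.2 : GL (Fin 3) (W.1.adicCompletion L)) * ((ph : GL (Fin 3) (W.1.adicCompletion L)) *
          (px : GL (Fin 3) (W.1.adicCompletion L)))) * (q.1 : GL (Fin 3) (W.1.adicCompletion L))⁻¹ =
        ((q.1 : GL (Fin 3) (W.1.adicCompletion L)) * ((q.2 : GL (Fin 3) (W.1.adicCompletion L)) * (ph : GL (Fin 3) (W.1.adicCompletion L))) *
          (q.1 : GL (Fin 3) (W.1.adicCompletion L))⁻¹) *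
          ((q.1 : GL (Fin 3) (W.1.adicCompletion L)) * (px : GL (Fin 3) (W.1.adicCompletion L)) * (q.1 : GL (Fin 3) (W.1.adicCompletion L))⁻¹) by group]
    exact hψr _ _ (hkxk q.1)
  have hsq := fun p : ↥P => rootDeltaChar_standardParabolicGL_eq_sqrt_normAbs_det_boxAd (W.1.adicCompletion L) (Zelevinsky1980.lastBlockLabel 3) p
  have hc : ∀ p : ↥P, ((normAbs (W.1.adicCompletion L) (Matrix.of fun q q' : {i : Fin 3 // Zelevinsky1980.lastBlockLabel 3 i = false} ×
        {j : Fin 3 // Zelevinsky1980.lastBlockLabel 3 j = true} =>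
          ((p : GL (Fin 3) (W.1.adicCompletion L)) : Matrix (Fin 3) (Fin 3) (W.1.adicCompletion L)) q.1 q'.1 *
            (((p⁻¹ : ↥P) : GL (Fin 3) (W.1.adicCompletion L)) : Matrix (Fin 3) (Fin 3) (W.1.adicCompletion L)) q'.2 q.2).det : ℝ≥0) : ℝ) =
      (((rootDeltaChar P p : ℂˣ) : ℂ)).re ^ 2 := fun p => by
    rw [hsq p, Complex.ofReal_re, Real.sq_sqrt (NNReal.coe_nonneg _)]
  have hne : (((rootDeltaChar P ph : ℂˣ) : ℂ)).re ^ 2 ≠ 0 := by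
    rw [← hc ph]
    intro h0
    have h1 := hsq ph
    rw [h0, Real.sqrt_zero, Complex.ofReal_zero] at h1
    exact (rootDeltaChar P ph).ne_zero h1
  have hI := key (ph * px)
  rw [hJ, key ph, hc, hc, hδr] at hI
  have hIr : I ph = I (ph * px) := smul_right_injective _ hne hI
  -- (5) assemble
  refine ⟨?_, ?_⟩
  · rw [hCT, hCT, hPl, ← hph, hδl, hIl]
  · rw [hCT, hCT, hPr, ← hph, hδr, ← hIr]

/-- **(s1) THE LEVEL OF `τ_w · φ̄^P`**: for `μ` UNRAMIFIED at `W` and `φ` bi-`K′`-invariant (`K′ = e′⁻¹ GL₃(𝒪_W)`, ★ `cmSplitMaxCompact`), the split-place transfer ★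
`cmSplitTransfer … φ = (νG K′ ∕ νH K_H) · μ_W(det e₂ ·) · φ̄^P` is bi-`K_H`-invariant (`K_H = U(Φ₂)(𝒪) × U(Φ₁)(𝒪)`, ★ `cmSplitLeviCompact`): `φ̄^P` by the two lemmas above, and
`μ_W(det (e₂ x.1)) = 1` for `x ∈ K_H` (`e₂ x.1 ∈ GL₂(𝒪_W)` ★ `reindexGL_finSumFinEquiv_blockDiagGL_mem_glInt_iff`, `|det| = 1` ★ `valuation_det_eq_one_of_mem_glInt`, `μ_W` trivial on
units ★ `IsUnramifiedAt.localComponent_eq_one_of_valuation_eq_one`) — «`f ↦ f̄^P` maps `ℋ(G, K)` to `ℋ(M, K ∩ M)`». [cite: CartierCorvallis1979, §IV.1–IV.2]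
[cite: Rogawski1990, §4.13 Lemma 4.13.1 (a) pp. 64–66; §4.9 Prop. 4.9.1 (a) p. 55] -/
theorem isLevel_cmSplitTransfer (μ : HeckeCharacter L) [MeasurableSpace (HLoc L v)] [MeasurableSpace ((cmDatum L 3 H').Local v)]
    (νH : Measure (HLoc L v)) (νG : Measure ((cmDatum L 3 H').Local v)) (hunr : μ.IsUnramifiedAt W.1)
    {f : (cmDatum L 3 H').Local v → ℂ} (hf : IsLevel (cmSplitMaxCompact L v W hW H' hH' hH'd) f) :
    IsLevel (cmSplitLeviCompact L v W hW) (cmSplitTransfer L H' hH' hH'd v W hW μ νH νG f) := by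
  have hτ : ∀ x ∈ cmSplitLeviCompact L v W hW, μ.localComponent W.1 (Matrix.GeneralLinearGroup.det (cmSplitEquivTwo L v W hW x.1)) = 1 := fun x hx => by
    have hx2 : cmSplitEquivTwo L v W hW x.1 ∈ glInt 2 (W.1.adicCompletion L) := by
      have h := (mem_cmSplitLeviCompact_iff L v W hW x).1 hx
      rw [cmSplitLeviGL_apply] at h
      exact ((reindexGL_finSumFinEquiv_blockDiagGL_mem_glInt_iff (k := 2) (l := 1) _).1 h).1
    refine hunr.localComponent_eq_one_of_valuation_eq_one ?_
    rw [Matrix.GeneralLinearGroup.val_det_apply]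
    exact valuation_det_eq_one_of_mem_glInt hx2
  refine ⟨(isCompact_isOpen_cmSplitLeviCompact L v W hW).2, (isCompact_isOpen_cmSplitLeviCompact L v W hW).1, fun x hx h => ?_, fun x hx h => ?_⟩
  · rw [cmSplitTransfer_apply, cmSplitTransfer_apply, (cmConstantTermSplit_apply_mul_eq_of_mem L v W hW H' hH' hH'd hf hx h).2, Prod.fst_mul, map_mul,
      map_mul, map_mul, hτ x hx, mul_one]
  · rw [cmSplitTransfer_apply, cmSplitTransfer_apply, (cmConstantTermSplit_apply_mul_eq_of_mem L v W hW H' hH' hH'd hf hx h).1, Prod.fst_mul, map_mul,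
      map_mul, map_mul, hτ x hx, one_mul]

end SplitLevel

/-! ## §2 (R-c)'s FL-existence hypothesis `hFL` AT A SPLIT PLACE, in the frozen currency -/

section Split

open Summit.HodgeConjecture.HodgeConjecture.R90.S3 (unopClassSphericalCharacter_eq_of_liesOver_of_sphTransfer eq_of_liesOver_of_sphTransfer)

variable {L : Type} [Field L] [NumberField L] [IsCMField L] {μ : HeckeCharacter L} {w : Pl L}
  {_msH : MeasurableSpace (HLoc L w)} [BorelSpace (HLoc L w)] {_msG : MeasurableSpace (Gqs L w)} [BorelSpace (Gqs L w)]
  {_qH : ∀ a : HLoc L w, MeasurableSpace (HLoc L w ⧸ Subgroup.centralizer ({a} : Set (HLoc L w)))}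
  [∀ a : HLoc L w, BorelSpace (HLoc L w ⧸ Subgroup.centralizer ({a} : Set (HLoc L w)))]
  {_qQ : ∀ γ : Gqs L w, MeasurableSpace (Gqs L w ⧸ Subgroup.centralizer ({γ} : Set (Gqs L w)))}
  [∀ γ : Gqs L w, BorelSpace (Gqs L w ⧸ Subgroup.centralizer ({γ} : Set (Gqs L w)))]
  {KG : Subgroup (Gqs L w)} {KHw : Subgroup (HLoc L w)} {νQw : Measure (Gqs L w)} {νHw : Measure (HLoc L w)}
  [νQw.IsHaarMeasure] [νQw.IsMulRightInvariant] [νHw.IsHaarMeasure] [νHw.IsMulRightInvariant]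
  {mHw : OrbitalMeasureFamily (HLoc L w)} {mQw : OrbitalMeasureFamily (Gqs L w)}
  {πw π₀ : IrrClass (Gqs L w)} {Vw : Type} [AddCommGroup Vw] [Module ℂ Vw] {ρw : Representation ℂ (HLoc L w) Vw}

/-- **(s1)+(s2) THE `K_{H,w}`-SPHERICAL `Δ_w`-TRANSFER EXISTS AT A SPLIT UNRAMIFIED PLACE** — the hypothesis `hFL` of ★ (R-a)(R-b)(R-c) (`R90S3BCSphericalRigidity`), DISCHARGED:
at a place `w` of `L⁺` split in `L` (`W ∣ w`, `c • W ≠ W`) with `μ` unramified at `W`, for the levels OF RECORD `K_w = U(Φ₃)(𝒪_w)` (`𝔳.hKstd`) and `K_{H,w} = U(Φ₂)(𝒪_w) ×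
U(Φ₁)(𝒪_w)` (`𝔥.hKH`, `hK₂std`, `hK₁std`), CANONICAL orbital families (`𝔳.hmH`, `𝔳.hmQ`) and Haar measures: every locally smooth `K_w`-bi-invariant `φ` on `G_w = U(Φ₃)(L⁺_w)` has the
`K_{H,w}`-bi-invariant partner `f^H := τ_w · φ̄^P =` ★ `cmSplitTransfer L (qsForm L) … w W hW μ νHw νQw φ` (p06 (g0)'s letter bytes) with ★ `MatchE1 L μ w mHw mQw f^H φ` — smoothness and
the `Δ_w`-identity by ★ `isLocalDeltaTransfer_cmSplitTransfer` [Lemma 4.13.1 (a)] ON THE NOSE, the level by `isLevel_cmSplitTransfer` through ★ (M-d)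
`cmSplitMaxCompact_qsForm_eq_cmLocalIntegralLevel` (`K′ = K_w`) and `cmSplitLeviCompact_eq_prod_cmLocalIntegralLevel` (`K_H = K_{H,w}`).
[cite: Rogawski1990, §4.13 Lemma 4.13.1 (a) pp. 64–66; §4.9 Prop. 4.9.1 (a) p. 55; §13.8 p. 219 L3] [cite: CartierCorvallis1979, §IV.1–IV.2] -/
theorem sphTransfer_exists_of_split (W : PlacesOver L w) (hW : IsCMField.complexConj L • W.1 ≠ W.1) (hunr : μ.IsUnramifiedAt W.1)
    (hdual : HeckeCharacter.galConj (IsCMField.complexConj L) μ = μ⁻¹) (hcanH : mHw.IsCanonical (IsLocalGRegular L w) νHw)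
    (hcanQ : mQw.IsCanonical (fun γ : Gqs L w => IsRegularElt (γ.val : GL (Fin 3) (UnitaryGroup.LocalRing L w))) νQw)
    (hKG : KG = cmLocalIntegralLevel L 3 (qsForm L) w)
    (hKH : KHw = (cmLocalIntegralLevel L 2 (Matrix.of fun i j : Fin 2 => if i.val + j.val + 1 = 2 then (1 : L) else 0) w).prod
      (cmLocalIntegralLevel L 1 (Matrix.of fun i j : Fin 1 => if i.val + j.val + 1 = 1 then (1 : L) else 0) w)) :
    ∀ φ : Gqs L w → ℂ, IsLocSmooth φ → IsLevel KG φ → ∃ fH : HLoc L w → ℂ, IsLevel KHw fH ∧ MatchE1 L μ w mHw mQw fH φ := by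
  intro φ hφ hφK
  subst hKG hKH
  letI : MeasurableSpace (W.1.adicCompletion L) := borel _
  haveI : BorelSpace (W.1.adicCompletion L) := ⟨rfl⟩
  have hT := isLocalDeltaTransfer_cmSplitTransfer L (qsForm L) (IsCMField.complexConj_ne_one L) W hW
    (antidiagOne_map_transpose (IsCMField.complexConj L) 2) (isUnit_placeForm_antidiagOne (E := L) 2 W.1)
    (antidiagOne_map_transpose (IsCMField.complexConj L) 1) (isUnit_placeForm_antidiagOne (E := L) 1 W.1)
    (antidiagOne_map_transpose (IsCMField.complexConj L) 3) (isUnit_placeForm_antidiagOne (E := L) 3 W.1)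
    (antidiagOne_isHermitian L 2) (isUnit_antidiagOne_det L 2).ne_zero (antidiagOne_isHermitian L 1) (isUnit_antidiagOne_det L 1).ne_zero μ
    (finExplicitDelta_conj_left_all L (qsForm L) μ) (finExplicitDelta_conj_right_all L (qsForm L) μ) hdual νHw νQw mHw mQw hcanH hcanQ
    (antidiagOne_isHermitian L 3) (isUnit_antidiagOne_det L 3) φ hφ
  refine ⟨cmSplitTransfer L (qsForm L) (antidiagOne_isHermitian L 3) (isUnit_antidiagOne_det L 3) w W hW μ νHw νQw φ, ?_, hT.1, hφ, hT.2⟩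
  rw [← cmSplitLeviCompact_eq_prod_cmLocalIntegralLevel L w W hW]
  refine isLevel_cmSplitTransfer L w W hW (qsForm L) (antidiagOne_isHermitian L 3) (isUnit_antidiagOne_det L 3) μ νHw νQw hunr ?_
  rw [cmSplitMaxCompact_qsForm_eq_cmLocalIntegralLevel L w W hW]
  exact hφK

/-! ## §3 HEAD: the BC-spherical input `hbc` at a split place, two-`LiesOver` form -/

/-- **HEAD — `hbc` AT A SPLIT UNRAMIFIED PLACE (two-`LiesOver` form, the split twin of #53): the e.v.p. components at `w` of two classes lying over the same `ρ_w` coincide.**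
If `πw` and `π₀` are ADMISSIBLE classes of `U(Φ₃)(L⁺_w)` both lying over `ρw` (★ `LiesOver`: `K_w`-spherical + `Tr π(φ) = Tr ρ_w(f^H)` on bi-invariant `Δ_w`-matched pairs) at a
place `w` split in `L` with `μ` unramified at `W ∣ w`, levels of record, canonical orbital families and Haar measures, then `unopClassSphericalCharacter K_w πw = unopClassSphericalCharacter
K_w π₀` — print's «`π_w = ξ_H(ρ_w)`» [p. 219 L3] read as rigidity of the fibre: ★ (R-c) `R90.S3.unopClassSphericalCharacter_eq_of_liesOver_of_sphTransfer` with its FL-existence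
hypothesis supplied by `sphTransfer_exists_of_split` (parabolic descent, Lemma 4.13.1 (a)); `K_w` compact open by ★ `isCompact_isOpen_cmLocalIntegralLevel`.
[cite: Rogawski1990, §13.8 p. 219 L3; §4.13 Lemma 4.13.1 (a) pp. 64–66; §13.6 p. 209] [cite: CartierCorvallis1979, §IV.1 Thm. 4.1, Cor. 4.1] -/
theorem unopClassSphericalCharacter_eq_of_liesOver_of_split (W : PlacesOver L w) (hW : IsCMField.complexConj L • W.1 ≠ W.1) (hunr : μ.IsUnramifiedAt W.1)
    (hdual : HeckeCharacter.galConj (IsCMField.complexConj L) μ = μ⁻¹) (hcanH : mHw.IsCanonical (IsLocalGRegular L w) νHw)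
    (hcanQ : mQw.IsCanonical (fun γ : Gqs L w => IsRegularElt (γ.val : GL (Fin 3) (UnitaryGroup.LocalRing L w))) νQw)
    (hKG : KG = cmLocalIntegralLevel L 3 (qsForm L) w)
    (hKH : KHw = (cmLocalIntegralLevel L 2 (Matrix.of fun i j : Fin 2 => if i.val + j.val + 1 = 2 then (1 : L) else 0) w).prod
      (cmLocalIntegralLevel L 1 (Matrix.of fun i j : Fin 1 => if i.val + j.val + 1 = 1 then (1 : L) else 0) w))
    (hadm : πw.IsAdmissible) (hadm₀ : π₀.IsAdmissible)
    (hLO : LiesOver L μ w KG KHw νQw νHw mHw mQw πw ρw) (hLO₀ : LiesOver L μ w KG KHw νQw νHw mHw mQw π₀ ρw) :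
    unopClassSphericalCharacter KG πw hLO.1 = unopClassSphericalCharacter KG π₀ hLO₀.1 :=
  unopClassSphericalCharacter_eq_of_liesOver_of_sphTransfer hadm hadm₀ (sphTransfer_exists_of_split W hW hunr hdual hcanH hcanQ hKG hKH) hLO hLO₀
    (by rw [hKG]; exact (isCompact_isOpen_cmLocalIntegralLevel L 3 (qsForm L) w).2)
    (by rw [hKG]; exact (isCompact_isOpen_cmLocalIntegralLevel L 3 (qsForm L) w).1)

/-- **THE CLASS FORM — the `LiesOver` fibre over `ρ_w` at a split unramified place is ONE admissible class**: under the same hypotheses `πw = π₀` (★ (R-b)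
`R90.S3.eq_of_liesOver_of_sphTransfer` ∘ `sphTransfer_exists_of_split`; Cartier Thm. 4.1: an admissible spherical class is determined by its eigencharacter).
[cite: Rogawski1990, §13.8 p. 219 L3; §4.13 Lemma 4.13.1 (a) pp. 64–66] [cite: CartierCorvallis1979, §IV.1 Thm. 4.1] -/
theorem eq_of_liesOver_of_split (W : PlacesOver L w) (hW : IsCMField.complexConj L • W.1 ≠ W.1) (hunr : μ.IsUnramifiedAt W.1)
    (hdual : HeckeCharacter.galConj (IsCMField.complexConj L) μ = μ⁻¹) (hcanH : mHw.IsCanonical (IsLocalGRegular L w) νHw)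
    (hcanQ : mQw.IsCanonical (fun γ : Gqs L w => IsRegularElt (γ.val : GL (Fin 3) (UnitaryGroup.LocalRing L w))) νQw)
    (hKG : KG = cmLocalIntegralLevel L 3 (qsForm L) w)
    (hKH : KHw = (cmLocalIntegralLevel L 2 (Matrix.of fun i j : Fin 2 => if i.val + j.val + 1 = 2 then (1 : L) else 0) w).prod
      (cmLocalIntegralLevel L 1 (Matrix.of fun i j : Fin 1 => if i.val + j.val + 1 = 1 then (1 : L) else 0) w))
    (hadm : πw.IsAdmissible) (hadm₀ : π₀.IsAdmissible)
    (hLO : LiesOver L μ w KG KHw νQw νHw mHw mQw πw ρw) (hLO₀ : LiesOver L μ w KG KHw νQw νHw mHw mQw π₀ ρw) : πw = π₀ :=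
  eq_of_liesOver_of_sphTransfer hadm hadm₀ (sphTransfer_exists_of_split W hW hunr hdual hcanH hcanQ hKG hKH) hLO hLO₀
    (by rw [hKG]; exact (isCompact_isOpen_cmLocalIntegralLevel L 3 (qsForm L) w).2)
    (by rw [hKG]; exact (isCompact_isOpen_cmLocalIntegralLevel L 3 (qsForm L) w).1)

end Split

/-! ## §4 The frozen-datum instance: `hbcSplit` for the keystone ∕ ★ `germOfMembersLetter_of_bcSpherical` -/

section Frozen

variable (L : Type) [Field L] [NumberField L] [IsCMField L] [DecidableEq (Pl L)] (μ : HeckeCharacter L) (v : Pl L)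
  [MeasurableSpace (HLoc L v)] [BorelSpace (HLoc L v)] [MeasurableSpace (Gqs L v)] [BorelSpace (Gqs L v)]
  (νHv : Measure (HLoc L v)) (νQv : Measure (Gqs L v)) [νHv.IsHaarMeasure] [νHv.IsMulRightInvariant] [νQv.IsHaarMeasure] [νQv.IsMulRightInvariant]
  [∀ a : HLoc L v, MeasurableSpace (HLoc L v ⧸ Subgroup.centralizer ({a} : Set (HLoc L v)))]
  [∀ a : HLoc L v, BorelSpace (HLoc L v ⧸ Subgroup.centralizer ({a} : Set (HLoc L v)))]
  [∀ γ : Gqs L v, MeasurableSpace (Gqs L v ⧸ Subgroup.centralizer ({γ} : Set (Gqs L v)))]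
  [∀ γ : Gqs L v, BorelSpace (Gqs L v ⧸ Subgroup.centralizer ({γ} : Set (Gqs L v)))]
  (mHv : OrbitalMeasureFamily (HLoc L v)) (mQv : OrbitalMeasureFamily (Gqs L v)) (πSt : IrrClass (HLoc L v))
  [MeasurableSpace (G3 L).Adelic] [BorelSpace (G3 L).Adelic] [MeasurableSpace (H2 L).Adelic] [BorelSpace (H2 L).Adelic]
  [MeasurableSpace (GArch L)] [BorelSpace (GArch L)] [MeasurableSpace (HArch L)] [BorelSpace (HArch L)]
  [MeasurableSpace (H1Loc L v)] [MeasurableSpace (H1Arch L)] [MeasurableSpace (H1 L).Adelic] [BorelSpace (H1 L).Adelic]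

/-- **`hbcSplit` IN THE FROZEN CURRENCY — the BC-spherical input of (13.8.3) at a SPLIT place `w ≠ v`, for the frozen datum `𝔣 = ⟨𝔥, 𝔳, 𝔤⟩`.**  At `w ≠ v` split in `L` (`W ∣ w`,
`c • W ≠ W`) with `μ` unramified at `W` (⟪U⟫ `(hunr w hw W).2`), two ADMISSIBLE classes `πw`, `π₀` of `U(Φ₃)(L⁺_w)` lying over `ρ_w` for the frozen levels ∕ measures ∕ orbital families
(`𝔳.K w`, `𝔥.KH w`, `𝔳.νQ w`, `𝔳.νHw w`, `𝔳.mH w`, `𝔳.mQ w` — canonical by `𝔳.hmH`, `𝔳.hmQ`, standard by `𝔳.hKstd`, `𝔥.hKH`, `𝔥.hK₂std`, `𝔥.hK₁std`) are EQUAL, so their spherical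
characters at `U(Φ₃)(𝒪_w)` (any sphericity witnesses `hsph`, `h₀`) coincide — exactly the `hbc` binder of ★ `germOfMembersLetter_of_bcSpherical` ∕ ★ `rigidityAtGermLetter_of_liesOver`
at a split `w`, once the keystone pins `t₀ w := unopClassSphericalCharacter _ π₀ h₀` on a class `π₀` lying over `ρ_w` (J-PIN (e) ★ `exists_liesOver_of_pinnedAt`).
[cite: Rogawski1990, §13.8 p. 219 L3; §4.13 Lemma 4.13.1 (a) pp. 64–66; §13.6 p. 209] [cite: CartierCorvallis1979, §IV.1 Thm. 4.1] -/
theorem eq_and_unopClassSphericalCharacter_eq_of_liesOver_frozen_of_split (𝔣 : S10FrozenDatum L μ v νHv νQv mHv mQv πSt) (w : {w : Pl L // w ≠ v})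
    (W : PlacesOver L w.1) (hW : IsCMField.complexConj L • W.1 ≠ W.1) (hunr : μ.IsUnramifiedAt W.1)
    (hdual : HeckeCharacter.galConj (IsCMField.complexConj L) μ = μ⁻¹)
    {πw π₀ : IrrClass (Gqs L w.1)} (hadm : πw.IsAdmissible) (hadm₀ : π₀.IsAdmissible)
    (hLO : LiesOver L μ w.1 (𝔣.𝔳.K w.1) (𝔣.𝔥.KH w.1) (𝔣.𝔳.νQ w) (𝔣.𝔳.νHw w) (𝔣.𝔳.mH w) (𝔣.𝔳.mQ w) πw (𝔣.𝔥.ρ w.1))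
    (hLO₀ : LiesOver L μ w.1 (𝔣.𝔳.K w.1) (𝔣.𝔥.KH w.1) (𝔣.𝔳.νQ w) (𝔣.𝔳.νHw w) (𝔣.𝔳.mH w) (𝔣.𝔳.mQ w) π₀ (𝔣.𝔥.ρ w.1))
    (hsph : πw.IsSpherical (cmLocalIntegralLevel L 3 (qsForm L) w.1)) (h₀ : π₀.IsSpherical (cmLocalIntegralLevel L 3 (qsForm L) w.1)) :
    πw = π₀ ∧ unopClassSphericalCharacter (cmLocalIntegralLevel L 3 (qsForm L) w.1) πw hsph =
      unopClassSphericalCharacter (cmLocalIntegralLevel L 3 (qsForm L) w.1) π₀ h₀ := by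
  haveI := 𝔣.𝔳.bsG w; haveI := 𝔣.𝔳.hνQ w; haveI := 𝔣.𝔳.hνQr w; haveI := 𝔣.𝔳.bqQ w
  haveI := 𝔣.𝔳.bsH w; haveI := 𝔣.𝔳.hνHw w; haveI := 𝔣.𝔳.hνHwr w; haveI := 𝔣.𝔳.bqH w
  letI := 𝔣.𝔥.acV; letI := 𝔣.𝔥.mdV
  obtain rfl : πw = π₀ := eq_of_liesOver_of_split W hW hunr hdual (𝔣.𝔳.hmH w) (𝔣.𝔳.hmQ w) (𝔣.𝔳.hKstd w.1 w.2)
    (by rw [𝔣.𝔥.hKH, 𝔣.𝔥.hK₂std w.1 w.2, 𝔣.𝔥.hK₁std w.1 w.2]) hadm hadm₀ hLO hLO₀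
  exact ⟨rfl, rfl⟩

end Frozen

end Summit.HodgeConjecture.HodgeConjecture.R90.S10

end
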